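import Summits.ResolutionOfSingularities.ResolutionOfSingularities.Theorems.EquisingularLiftEquisingularLiftNatConeChart
import Literature.AlgebraicGeometry.Resolution.BlowupAlgebraStrictTransform
import HarnessLib

/-!
# [OURS · L1 W4.5(b) · EL♮(3)] T-EBETA-PRIME, ring core, part 1 (chart algebra): the strict transform of a
# hypersurface `G = Φ(x) + Ψ` with tangent cone `V(Φ̄)` on the chart `A[I/xᵢ]` — presentation `G = tᵈ·(Φ(e) + tψ)`,
# exceptional fibre `≅ (A/I)[T]/(Φ̄ᵢ)`, strict-transform ideal `(Φ(e) + tψ)`, chart ring `≅ (A/(G))[Ī/x̄ᵢ]`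

Support file of the crux chain w45b (cell `res-hironaka`, LADDER-RESOLUTION rung L, slot W4.5(b)), working crux
**EL♮ = `Theses.EquisingularLift.EquisingularLiftNat`** (stmt-ResolutionOfSingularities-20038) and its `n = 3` child
`EquisingularLiftNatThree` (stmt-ResolutionOfSingularities-20148), registered stub `stub_elnat_three_isolated_nonabs`
(line `sections`). OURS; NOT a statement of any manuscript; AI-written, weaker than expert review. Filed
`--supports stmt-ResolutionOfSingularities-20148 --as helper` by res-L1-w45b-stub-3 (self-dealt object T-EBETA-PRIME,
STATUS 2026-08-27T07:35Z). Part 2 (`…NatSmoothConeBlowup`: the derivative test, the Jacobian packaging and the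
REGULARITY of the blow-up along the exceptional divisor) imports this file.

WHY. At a TIE point `q` of the isolated game (res-L1-w45b-plan-1 PLANNER-MEMO v2 M3, specimen S-F; res-L1-w45b-lead-2
LEAD-MEMO-2 §5–§6) the device of record is (E-β′): a transversal section at `q`, then the centre `C = Bl_q(D)` for the
`O`-model `D = V(G̃) ⊂ E_O ≅ ℙ²_O` of the curve, `G̃ = F̃ + ϖᵐ U` with `U(q)` matched to the tie coefficient, so that
the TANGENT CONE of `D` at `q` is the cone over a SMOOTH plane curve (for S-F: the cubic `ℓℓ′ℓ″ + U(q) ϖ̄³`).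
Admissibility of `C` needs `Bl_q(D)` REGULAR along its exceptional curve and that curve to BE the smooth plane curve
(E1 «via the reduced cubic»). The two files prove exactly that, at the ring level and in any dimension; this part is
the chart algebra generalising res-type-100's `…NatConeChart` (p508912) from the pure cone `V(Φ(x))` to
`V(Φ(x) + Ψ)`, `Ψ ∈ I^{d+1}`.

RING-LEVEL STATEMENT (everything for an arbitrary commutative ring `A`). Let `x = (x₁, …, x_r)` be a sequence in `A`,
`I = (x)`, `B = A[I/xᵢ]` the affine blowup algebra (`blowupAlgebra`, image model), `t = xᵢ/1` the equation of the
exceptional divisor, `e_j = x_j/xᵢ`, and `G = Φ(x) + Ψ` with `Φ ∈ A[T₁, …, T_r]` a FORM of degree `d` and `Ψ ∈ I^{d+1}`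
(so `V(Φ̄) ⊂ ℙ^{r-1}_{A/I}` is the tangent cone of `V(G)` along `V(I)` when `Φ̄ ≠ 0`). Then on the chart:

* `exists_algebraMap_eq_pow_mul_of_mem_pow` — `Ψ ∈ Iⁿ ⇒ Ψ = tⁿ ψ` in `B` (Stacks 052Q);
  `exists_algebraMap_tangentCone_eq` — **`G = tᵈ · g₁` with `g₁ = Φ(e) + t ψ`** (`Φ(e)` = the cone transform of
  `…NatConeChart`); all later statements are about such a `g₁ = Φ(e) + t ψ`, `ψ ∈ B` arbitrary;
* `span_strictTransform_sup_span_eq`, `exists_quotient_strictTransform_sup_equiv`, `mk_strictTransform_eq` —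
  `(g₁, t) = (Φ(e), t)`, hence **`B/(g₁, t) ≅ (A/I)[T_j : j ≠ i]/(Φ̄ᵢ)`**: the exceptional fibre of the strict transform on
  the chart IS the affine piece `V(Φ̄ᵢ)` of the projectivised tangent cone (`Φ̄ᵢ` = dehomogenised reduced form);
* `mem_span_algebraMap_of_strictTransform_mul_mem`, `mem_span_strictTransform_of_algebraMap_mul_mem`,
  `iSup_colon_span_tangentCone_eq_span_strictTransform`, `prime_algebraMap_blowupAlgebra`,
  `ker_mapQuotient_tangentCone_eq_span`, `exists_quotient_strictTransform_equiv_blowupAlgebra` — for `A/I` a domain,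
  `x` quasi-regular and `Φ̄ᵢ ≠ 0`: `g₁, t` is a regular sequence either way round, the STRICT transform ideal
  `⋃ₙ ((G) : tⁿ)` is `(g₁)`, it is the kernel of `B → (A/(G))[Ī/x̄ᵢ]`, and **`B/(g₁) ≅ (A/(G))[Ī/x̄ᵢ]`** = the chart ring of
  `Bl_{V(I)} V(G)`.

References: The Stacks Project, Tags 052Q, 0BIQ, 07Z3; Görtz–Wedhorn, *Algebraic Geometry I* (2020), (13.19) and
Prop. 13.96. Tree inputs: `…NatConeChart` (p508912, res-type-100), `BlowupAlgebraStrictTransform`,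
`BlowupAlgebraPresentation`, `BlowupAlgebraQuasiRegularChart`.
-/

set_option linter.dupNamespace false -- mandated namespace `Summit.<Summit>.<Problem>` of this single-conjunct summit

noncomputable section

namespace Summit.ResolutionOfSingularities.ResolutionOfSingularities.Cruxes.EquisingularLiftNat.Sections

open MvPolynomial IsLocalization IsLocalRing Literature.AlgebraicGeometry.Resolution

universe u

section Chart

variable {A : Type u} [CommRing A] {r : ℕ} (x : Fin r → A) (i : Fin r)

/-! ## The presentation `G = tᵈ · (Φ(e) + t ψ)` on the chart -/

/-- **`Ψ ∈ Iⁿ` is `tⁿ · ψ` on the chart `A[I/xᵢ]`** (`t = xᵢ/1`; Stacks 052Q: the elements of `A[I/xᵢ]` are the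
`y/xᵢⁿ`, `y ∈ Iⁿ`). [cite: StacksProject, Tag 052Q] -/
theorem exists_algebraMap_eq_pow_mul_of_mem_pow {n : ℕ} {Ψ : A} (hΨ : Ψ ∈ Ideal.span (Set.range x) ^ n) :
    ∃ ψ : blowupAlgebra (Ideal.span (Set.range x)) (x i),
      algebraMap A (blowupAlgebra (Ideal.span (Set.range x)) (x i)) Ψ =
        algebraMap A (blowupAlgebra (Ideal.span (Set.range x)) (x i)) (x i) ^ n * ψ := by
  refine ⟨⟨_, algebraMap_mul_invSelf_pow_mem_blowupAlgebra (I := Ideal.span (Set.range x)) (x i) n hΨ⟩, ?_⟩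
  apply Subtype.ext
  simp only [Subalgebra.coe_algebraMap, Subalgebra.coe_mul, Subalgebra.coe_pow]
  rw [mul_left_comm, ← mul_pow, IsLocalization.Away.mul_invSelf, one_pow, mul_one]

/-- **`G = Φ(x) + Ψ = tᵈ · (Φ(e) + t ψ)` on the chart** for a form `Φ` of degree `d` and `Ψ ∈ I^{d+1}`: the total
transform of the hypersurface is `d` times the exceptional divisor plus `V(Φ(e) + tψ)`. [cite: GortzWedhorn2020, (13.19) p. 414] -/
theorem exists_algebraMap_tangentCone_eq {d : ℕ} {Φ : MvPolynomial (Fin r) A} (hΦ : Φ.IsHomogeneous d) {Ψ : A}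
    (hΨ : Ψ ∈ Ideal.span (Set.range x) ^ (d + 1)) :
    ∃ ψ : blowupAlgebra (Ideal.span (Set.range x)) (x i),
      algebraMap A (blowupAlgebra (Ideal.span (Set.range x)) (x i)) (MvPolynomial.eval x Φ + Ψ) =
        algebraMap A (blowupAlgebra (Ideal.span (Set.range x)) (x i)) (x i) ^ d *
          (MvPolynomial.aeval (blowupAlgebra.frac x i) Φ +
            algebraMap A (blowupAlgebra (Ideal.span (Set.range x)) (x i)) (x i) * ψ) := by
  obtain ⟨ψ, hψ⟩ := exists_algebraMap_eq_pow_mul_of_mem_pow x i hΨ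
  refine ⟨ψ, ?_⟩
  rw [map_add, algebraMap_eval_eq_pow_mul_coneTransform x i hΦ, hψ, pow_succ]
  ring

/-! ## The exceptional fibre of the strict transform: `(g₁, t) = (Φ(e), t)` -/

/-- `(Φ(e) + t ψ, t) = (Φ(e), t)` as ideals of the chart. [folklore] -/
theorem span_strictTransform_sup_span_eq (Φ : MvPolynomial (Fin r) A)
    (ψ : blowupAlgebra (Ideal.span (Set.range x)) (x i)) :
    Ideal.span {MvPolynomial.aeval (blowupAlgebra.frac x i) Φ +
        algebraMap A (blowupAlgebra (Ideal.span (Set.range x)) (x i)) (x i) * ψ} ⊔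
      Ideal.span {algebraMap A (blowupAlgebra (Ideal.span (Set.range x)) (x i)) (x i)} =
    Ideal.span {MvPolynomial.aeval (blowupAlgebra.frac x i) Φ} ⊔
      Ideal.span {algebraMap A (blowupAlgebra (Ideal.span (Set.range x)) (x i)) (x i)} := by
  set t := algebraMap A (blowupAlgebra (Ideal.span (Set.range x)) (x i)) (x i)
  set c := MvPolynomial.aeval (blowupAlgebra.frac x i) Φ
  apply le_antisymm
  · refine sup_le ?_ le_sup_right
    rw [Ideal.span_singleton_le_iff_mem]
    exact Submodule.add_mem_sup (Ideal.mem_span_singleton_self c)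
      (Ideal.mem_span_singleton'.mpr ⟨ψ, mul_comm ψ t⟩)
  · refine sup_le ?_ le_sup_right
    rw [Ideal.span_singleton_le_iff_mem]
    have h1 : c + t * ψ ∈ Ideal.span {c + t * ψ} ⊔ Ideal.span {t} :=
      Submodule.mem_sup_left (Ideal.mem_span_singleton_self _)
    have h2 : t * ψ ∈ Ideal.span {c + t * ψ} ⊔ Ideal.span {t} :=
      Submodule.mem_sup_right (Ideal.mem_span_singleton'.mpr ⟨ψ, mul_comm ψ t⟩)
    have h3 := sub_mem h1 h2
    rwa [add_sub_cancel_right] at h3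

/-- **`A[I/xᵢ]/(g₁, t) ≅ (A/I)[T_j : j ≠ i]/(Φ̄ᵢ)`** (`g₁ = Φ(e) + tψ`, `x` quasi-regular), with `a/1 ↦ ā` and
`x_j/xᵢ ↦ T_j`: on the chart, the scheme-theoretic intersection of the strict transform `V(g₁)` with the exceptional
divisor is the affine piece `V(Φ̄ᵢ) ⊂ 𝔸^{r-1}_{A/I}` of the projectivised tangent cone. [cite: StacksProject, Tag 0BIQ] -/
theorem exists_quotient_strictTransform_sup_equiv (hx : IsQuasiRegular x) (Φ : MvPolynomial (Fin r) A)
    (ψ : blowupAlgebra (Ideal.span (Set.range x)) (x i)) :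
    ∃ ε : (blowupAlgebra (Ideal.span (Set.range x)) (x i) ⧸
        (Ideal.span {MvPolynomial.aeval (blowupAlgebra.frac x i) Φ +
            algebraMap A (blowupAlgebra (Ideal.span (Set.range x)) (x i)) (x i) * ψ} ⊔
          Ideal.span {algebraMap A (blowupAlgebra (Ideal.span (Set.range x)) (x i)) (x i)})) ≃+*
        (MvPolynomial {j : Fin r // j ≠ i} (A ⧸ Ideal.span (Set.range x)) ⧸
          Ideal.span {MvPolynomial.map (Ideal.Quotient.mk (Ideal.span (Set.range x))) (dehomogenize i Φ)}),
      (∀ a : A, ε (Ideal.Quotient.mk _ (algebraMap A _ a)) =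
        Ideal.Quotient.mk _ (MvPolynomial.C (Ideal.Quotient.mk _ a))) ∧
      (∀ j : {j : Fin r // j ≠ i}, ε (Ideal.Quotient.mk _ (blowupAlgebra.frac x i j.1)) =
        Ideal.Quotient.mk _ (MvPolynomial.X j)) := by
  obtain ⟨ε, hC, hX⟩ := exists_quotient_coneTransform_sup_equiv x i hx Φ
  refine ⟨(Ideal.quotEquivOfEq (span_strictTransform_sup_span_eq x i Φ ψ)).trans ε, fun a => ?_, fun j => ?_⟩
  · rw [RingEquiv.trans_apply, Ideal.quotEquivOfEq_mk]
    exact hC a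
  · rw [RingEquiv.trans_apply, Ideal.quotEquivOfEq_mk]
    exact hX j

/-- The class of `g₁ = Φ(e) + tψ` modulo `t` is the dehomogenised reduced form `Φ̄ᵢ` under
`(A/I)[T_j : j ≠ i] ≅ A[I/xᵢ]/(t)` (`blowupAlgebraQuotEquiv`, `x` quasi-regular). [cite: StacksProject, Tag 0BIQ] -/
theorem mk_strictTransform_eq (hx : IsQuasiRegular x) (Φ : MvPolynomial (Fin r) A)
    (ψ : blowupAlgebra (Ideal.span (Set.range x)) (x i)) :
    Ideal.Quotient.mk (Ideal.span {algebraMap A (blowupAlgebra (Ideal.span (Set.range x)) (x i)) (x i)})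
        (MvPolynomial.aeval (blowupAlgebra.frac x i) Φ +
          algebraMap A (blowupAlgebra (Ideal.span (Set.range x)) (x i)) (x i) * ψ) =
      blowupAlgebraQuotEquiv x i hx
        (MvPolynomial.map (Ideal.Quotient.mk (Ideal.span (Set.range x))) (dehomogenize i Φ)) := by
  rw [map_add, mk_coneTransform_eq x i hx Φ, map_mul,
    Ideal.Quotient.eq_zero_iff_mem.mpr (Ideal.mem_span_singleton_self _), zero_mul, add_zero]

/-! ## The strict transform ideal is `(g₁)` -/

variable [IsDomain (A ⧸ Ideal.span (Set.range x))]

/-- For `V(I)` integral, `x` quasi-regular and `Φ̄ᵢ ≠ 0`: `g₁ = Φ(e) + tψ` is a nonzerodivisor modulo `t`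
(`g₁ y ∈ (t) ⇒ y ∈ (t)`; the exceptional divisor `A[I/xᵢ]/(t) ≅ (A/I)[T]` of the chart is a domain). [folklore] -/
theorem mem_span_algebraMap_of_strictTransform_mul_mem (hx : IsQuasiRegular x) {Φ : MvPolynomial (Fin r) A}
    (hΦ : MvPolynomial.map (Ideal.Quotient.mk (Ideal.span (Set.range x))) (dehomogenize i Φ) ≠ 0)
    (ψ y : blowupAlgebra (Ideal.span (Set.range x)) (x i))
    (hy : (MvPolynomial.aeval (blowupAlgebra.frac x i) Φ +
        algebraMap A (blowupAlgebra (Ideal.span (Set.range x)) (x i)) (x i) * ψ) * y ∈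
      Ideal.span {algebraMap A (blowupAlgebra (Ideal.span (Set.range x)) (x i)) (x i)}) :
    y ∈ Ideal.span {algebraMap A (blowupAlgebra (Ideal.span (Set.range x)) (x i)) (x i)} := by
  haveI : IsDomain (blowupAlgebra (Ideal.span (Set.range x)) (x i) ⧸
      Ideal.span {algebraMap A (blowupAlgebra (Ideal.span (Set.range x)) (x i)) (x i)}) :=
    MulEquiv.isDomain (MvPolynomial {j : Fin r // j ≠ i} (A ⧸ Ideal.span (Set.range x)))
      (blowupAlgebraQuotEquiv x i hx).symm.toMulEquiv
  refine mem_span_singleton_of_mul_mem_of_isDomain ?_ y hy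
  rw [mk_strictTransform_eq x i hx]
  exact fun h => hΦ ((blowupAlgebraQuotEquiv x i hx).injective (h.trans (map_zero _).symm))

/-- … hence `t` is a nonzerodivisor modulo `g₁`: `t y ∈ (g₁) ⇒ y ∈ (g₁)`. [folklore] -/
theorem mem_span_strictTransform_of_algebraMap_mul_mem (hx : IsQuasiRegular x) {Φ : MvPolynomial (Fin r) A}
    (hΦ : MvPolynomial.map (Ideal.Quotient.mk (Ideal.span (Set.range x))) (dehomogenize i Φ) ≠ 0)
    (ψ y : blowupAlgebra (Ideal.span (Set.range x)) (x i))
    (hy : algebraMap A (blowupAlgebra (Ideal.span (Set.range x)) (x i)) (x i) * y ∈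
      Ideal.span {MvPolynomial.aeval (blowupAlgebra.frac x i) Φ +
        algebraMap A (blowupAlgebra (Ideal.span (Set.range x)) (x i)) (x i) * ψ}) :
    y ∈ Ideal.span {MvPolynomial.aeval (blowupAlgebra.frac x i) Φ +
        algebraMap A (blowupAlgebra (Ideal.span (Set.range x)) (x i)) (x i) * ψ} :=
  mem_span_singleton_of_mul_mem_of_swap (S := blowupAlgebra (Ideal.span (Set.range x)) (x i))
    (t := algebraMap A (blowupAlgebra (Ideal.span (Set.range x)) (x i)) (x i))
    (algebraMap_mem_nonZeroDivisors_blowupAlgebra (I := Ideal.span (Set.range x)) (a := x i))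
    (mem_span_algebraMap_of_strictTransform_mul_mem x i hx hΦ ψ) hy

/-- **The strict transform of `V(G)` on the chart is `V(g₁)`**: the saturation `⋃ₙ ((G) : tⁿ)` of the total transform
by the exceptional divisor is the principal ideal `(g₁)`, whenever `G = tᵈ g₁` with `g₁ = Φ(e) + tψ`, `V(I)` integral,
`x` quasi-regular and `Φ̄ᵢ ≠ 0`. [cite: GortzWedhorn2020, (13.19) p. 414] -/
theorem iSup_colon_span_tangentCone_eq_span_strictTransform (hx : IsQuasiRegular x) {d : ℕ}
    {Φ : MvPolynomial (Fin r) A}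
    (hΦ : MvPolynomial.map (Ideal.Quotient.mk (Ideal.span (Set.range x))) (dehomogenize i Φ) ≠ 0)
    (ψ : blowupAlgebra (Ideal.span (Set.range x)) (x i)) {G : A}
    (hG : algebraMap A (blowupAlgebra (Ideal.span (Set.range x)) (x i)) G =
      algebraMap A (blowupAlgebra (Ideal.span (Set.range x)) (x i)) (x i) ^ d *
        (MvPolynomial.aeval (blowupAlgebra.frac x i) Φ +
          algebraMap A (blowupAlgebra (Ideal.span (Set.range x)) (x i)) (x i) * ψ)) :
    ⨆ n : ℕ, Submodule.colon
        (Ideal.span {algebraMap A (blowupAlgebra (Ideal.span (Set.range x)) (x i)) G})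
        ((Ideal.span {algebraMap A (blowupAlgebra (Ideal.span (Set.range x)) (x i)) (x i)} ^ n :
          Ideal (blowupAlgebra (Ideal.span (Set.range x)) (x i))) : Set _) =
      Ideal.span {MvPolynomial.aeval (blowupAlgebra.frac x i) Φ +
        algebraMap A (blowupAlgebra (Ideal.span (Set.range x)) (x i)) (x i) * ψ} := by
  rw [hG]
  exact iSup_colon_span_pow_mul_eq (S := blowupAlgebra (Ideal.span (Set.range x)) (x i))
    (t := algebraMap A (blowupAlgebra (Ideal.span (Set.range x)) (x i)) (x i))
    (algebraMap_mem_nonZeroDivisors_blowupAlgebra (I := Ideal.span (Set.range x)) (a := x i))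
    (fun y hy => mem_span_strictTransform_of_algebraMap_mul_mem x i hx hΦ ψ y hy) d

/-- `t = xᵢ/1` is a PRIME element of `A[I/xᵢ]` (`V(I)` integral, `x` quasi-regular: the ideal `(t)` is prime,
`blowupAlgebra.isPrime_span_algebraMap`, and `t` is a nonzerodivisor, so `t ≠ 0`). [cite: StacksProject, Tag 0BIQ] -/
theorem prime_algebraMap_blowupAlgebra (hx : IsQuasiRegular x) :
    Prime (algebraMap A (blowupAlgebra (Ideal.span (Set.range x)) (x i)) (x i)) := by
  have hP := blowupAlgebra.isPrime_span_algebraMap x i hx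
  haveI : Nontrivial (blowupAlgebra (Ideal.span (Set.range x)) (x i)) := by
    by_contra h
    rw [not_nontrivial_iff_subsingleton] at h
    exact hP.ne_top (Subsingleton.elim _ _)
  have hne : algebraMap A (blowupAlgebra (Ideal.span (Set.range x)) (x i)) (x i) ≠ 0 :=
    nonZeroDivisors.ne_zero
      (algebraMap_mem_nonZeroDivisors_blowupAlgebra (I := Ideal.span (Set.range x)) (a := x i))
  exact (Ideal.span_singleton_prime hne).mp hP

/-- **The kernel of `A[I/xᵢ] → (A/(G))[Ī/x̄ᵢ]` is `(g₁)`** (`G = tᵈ g₁`, `g₁ = Φ(e) + tψ`, `V(I)` integral, `x`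
quasi-regular, `Φ̄ᵢ ≠ 0`): the strict transform ideal computed as a kernel (McCoy / GW 13.96 (2)).
[cite: GortzWedhorn2020, Prop. 13.96 (2) and p. 416] -/
theorem ker_mapQuotient_tangentCone_eq_span (hx : IsQuasiRegular x) {d : ℕ} {Φ : MvPolynomial (Fin r) A}
    (hΦ : MvPolynomial.map (Ideal.Quotient.mk (Ideal.span (Set.range x))) (dehomogenize i Φ) ≠ 0)
    (ψ : blowupAlgebra (Ideal.span (Set.range x)) (x i)) {G : A}
    (hG : algebraMap A (blowupAlgebra (Ideal.span (Set.range x)) (x i)) G =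
      algebraMap A (blowupAlgebra (Ideal.span (Set.range x)) (x i)) (x i) ^ d *
        (MvPolynomial.aeval (blowupAlgebra.frac x i) Φ +
          algebraMap A (blowupAlgebra (Ideal.span (Set.range x)) (x i)) (x i) * ψ)) :
    RingHom.ker (blowupAlgebra.mapQuotient (Ideal.span (Set.range x)) (x i) (Ideal.span {G})) =
      Ideal.span {MvPolynomial.aeval (blowupAlgebra.frac x i) Φ +
        algebraMap A (blowupAlgebra (Ideal.span (Set.range x)) (x i)) (x i) * ψ} := by
  refine blowupAlgebra.ker_mapQuotient_eq_span (Ideal.span (Set.range x)) (x i) hG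
    (prime_algebraMap_blowupAlgebra x i hx) ?_
  intro hdvd
  have hmem : MvPolynomial.aeval (blowupAlgebra.frac x i) Φ +
      algebraMap A (blowupAlgebra (Ideal.span (Set.range x)) (x i)) (x i) * ψ ∈
        Ideal.span {algebraMap A (blowupAlgebra (Ideal.span (Set.range x)) (x i)) (x i)} :=
    Ideal.mem_span_singleton.mpr hdvd
  rw [← Ideal.Quotient.eq_zero_iff_mem, mk_strictTransform_eq x i hx] at hmem
  exact hΦ ((blowupAlgebraQuotEquiv x i hx).injective (hmem.trans (map_zero _).symm))

/-- **`A[I/xᵢ]/(g₁) ≅ (A/(G))[Ī/x̄ᵢ]`**: the chart ring of the blow-up `Bl_{V(I)} V(G)` of the hypersurface along the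
centre is the quotient of the chart ring of the blow-up of `Spec A` by the strict transform `g₁ = Φ(e) + tψ` (same
hypotheses), compatibly with `A[I/xᵢ] → (A/(G))[Ī/x̄ᵢ]`. [cite: GortzWedhorn2020, Prop. 13.96 (2) and p. 416] -/
theorem exists_quotient_strictTransform_equiv_blowupAlgebra (hx : IsQuasiRegular x) {d : ℕ}
    {Φ : MvPolynomial (Fin r) A}
    (hΦ : MvPolynomial.map (Ideal.Quotient.mk (Ideal.span (Set.range x))) (dehomogenize i Φ) ≠ 0)
    (ψ : blowupAlgebra (Ideal.span (Set.range x)) (x i)) {G : A}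
    (hG : algebraMap A (blowupAlgebra (Ideal.span (Set.range x)) (x i)) G =
      algebraMap A (blowupAlgebra (Ideal.span (Set.range x)) (x i)) (x i) ^ d *
        (MvPolynomial.aeval (blowupAlgebra.frac x i) Φ +
          algebraMap A (blowupAlgebra (Ideal.span (Set.range x)) (x i)) (x i) * ψ)) :
    ∃ ε : (blowupAlgebra (Ideal.span (Set.range x)) (x i) ⧸
        Ideal.span {MvPolynomial.aeval (blowupAlgebra.frac x i) Φ +
          algebraMap A (blowupAlgebra (Ideal.span (Set.range x)) (x i)) (x i) * ψ}) ≃+*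
        blowupAlgebra ((Ideal.span (Set.range x)).map (Ideal.Quotient.mk (Ideal.span {G})))
          (Ideal.Quotient.mk (Ideal.span {G}) (x i)),
      ∀ g, ε (Ideal.Quotient.mk _ g) = blowupAlgebra.mapQuotient (Ideal.span (Set.range x)) (x i) (Ideal.span {G}) g := by
  have hndvd : ¬ algebraMap A (blowupAlgebra (Ideal.span (Set.range x)) (x i)) (x i) ∣
      MvPolynomial.aeval (blowupAlgebra.frac x i) Φ +
        algebraMap A (blowupAlgebra (Ideal.span (Set.range x)) (x i)) (x i) * ψ := by
    intro hdvd
    have hmem : MvPolynomial.aeval (blowupAlgebra.frac x i) Φ +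
        algebraMap A (blowupAlgebra (Ideal.span (Set.range x)) (x i)) (x i) * ψ ∈
          Ideal.span {algebraMap A (blowupAlgebra (Ideal.span (Set.range x)) (x i)) (x i)} :=
      Ideal.mem_span_singleton.mpr hdvd
    rw [← Ideal.Quotient.eq_zero_iff_mem, mk_strictTransform_eq x i hx] at hmem
    exact hΦ ((blowupAlgebraQuotEquiv x i hx).injective (hmem.trans (map_zero _).symm))
  exact ⟨blowupAlgebra.quotientKerMapQuotientEquiv (Ideal.span (Set.range x)) (x i) hG
    (prime_algebraMap_blowupAlgebra x i hx) hndvd, fun g => rfl⟩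

end Chart

end Summit.ResolutionOfSingularities.ResolutionOfSingularities.Cruxes.EquisingularLiftNat.Sections

end
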